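import Summits.CriticalPhenomena.Ising3DConformalLimit.Theses.LeeYangGap
import Summits.CriticalPhenomena.Ising3DConformalLimit.Theorems.PerfectScreeningCoulombImpliesNontrivialBlockVariance
import Summits.CriticalPhenomena.Ising3DConformalLimit.Theorems.LeeYangGapGaussianLimitKillsBlockCouplingBlockSums
import Literature.Probability.LatticeModels.DirInvCorrLength
import Literature.Probability.LatticeModels.SusceptibilityMeanFieldBound

/-!
# The critical-window variance bound (stub `stub_criticalWindowVariance`): reductions

Route `LeeYangGap` (Ising3DConformalLimit), crux `NearCriticalLeeYangGap` (item stmt-CriticalPhenomena-4945),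
line `registered`. The birth stub S2 `stub_criticalWindowVariance` is NOT proved here (it is open on `ℤ³`);
this file proves the registered glue stub S2g `stub_criticalWindowVariance_of_susceptibilityComparability`
of the reshaped skeleton (S2 from the registered open core S2χ `stub_susceptibilityComparability`) and the
converse, so that S2χ is exactly the content of S2. Notation (`d = 3`, nearest-neighbour Ising): `Λ_L = box 3 L`,
`Σ_L = ⟨M_L²⟩_{β_c} = plusExpect 3 β_c 0 ((Σ_{x ∈ Λ_L} σ_x)²)` (the CRITICAL block variance),
`G_c(z) = ⟨σ₀σ_z⟩⁺_{β_c} = twoPointPlus 3 β_c z`, `χ(β) = susceptibility 3 β` (free state, in `ℝ≥0∞`),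
`ξ(β) = isingCorrLength 3 β` (plus-state axis correlation length), `χ_n(β_c) = Σ_{z ∈ Λ_n} G_c(z)`.

S2 says: `∀ K > 0 ∃ B > 0 ∃ β₂ < β_c ∀ β ∈ [β₂, β_c) ∀ L ≤ K ξ(β), Σ_L ≤ B χ(β) ξ(β)³`.

What is proved here (everything sorry-free):

* `sum_twoPointFree_le_susceptibility_toReal` — finite partial sums `Σ_{z ∈ S} ⟨σ₀σ_z⟩^∅_β ≤ χ(β)`
  when `χ(β) < ∞`;
* `isingCorrLength_pos`, `isingCorrLength_mono` — `0 < ξ(β)` and `ξ` nondecreasing on `(0, β_c)`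
  (sharpness: Aizenman–Barsky–Fernández 1987; GKS monotonicity in `β`);
* `criticalBlockVariance_le_card_mul_boxSum` — `Σ_L ≤ |Λ_L| χ_{2L}(β_c)` (rows re-indexed into `Λ_{2L}`);
* `criticalBlockVariance_le_pow_five` — the UNCONDITIONAL infrared half `Σ_L ≤ C L⁵` (`L ≥ 1`), from
  `G_c(z) ≤ C/‖z‖` (Fröhlich–Simon–Spencer 1976 / Duminil-Copin 2019 Thm. 4.8, tree theorem
  `criticalTwoPoint_bounds_holds`); it does NOT give S2 (that would need `χ(β) ≥ c ξ(β)²`, false if `η > 0`);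
* `boxSum_le_of_twoPoint_le`, `susceptibilityComparability_of_twoPointComparability` — pointwise
  near-critical comparability `G_c(z) ≤ A ⟨σ₀σ_z⟩^∅_β` on `‖z‖ ≤ R ξ(β)` implies the averaged form
  `χ_n(β_c) ≤ A χ(β)` for `n ≤ R ξ(β)`;
* `criticalWindowVariance_of_boxSum_le` (one `K`, from the averaged comparability at scale `2K`) and
  **`stub_criticalWindowVariance_of_susceptibilityComparability`** — the averaged comparability
  (all `R > 0`) implies S2 verbatim (`B = A (2K + 1/ξ₀)³`, `ξ₀ = ξ(β₂ ∨ β_c/2)`, with the `A, β₂` of `R = 2K`);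
* **`stub_criticalWindowVariance_of_comparability`** — pointwise comparability (all `R > 0`) implies S2;
* `susceptibilityComparability_of_stub_criticalWindowVariance` — conversely S2 implies the averaged
  comparability (via `|Λ_{L/2}| χ_{L/2}(β_c) ≤ Σ_L`), so the averaged comparability is EXACTLY the
  content of the stub.

The missing estimate (open on `ℤ³`; its `d ≥ 5` analogue at the window scale `‖z‖ ≤ L(β) ≍ ξ(β)`,
`L(β)` the sharp length, is Duminil-Copin–Panis, CMP 406 (2025), arXiv:2404.05700, Thm. 1.4 with
Rem. 1.7) is the hypothesis of `stub_criticalWindowVariance_of_susceptibilityComparability` (averaged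
form, needed only at `R = 2K` for the `K` of S1: `criticalWindowVariance_of_boxSum_le`) or of
`stub_criticalWindowVariance_of_comparability` (pointwise form); physically both are the amplitude
form of the Fisher half `γ ≥ (2 - η) ν` (`Σ_L(β_c) ≍ L^{5-η}`, `χ(β) ξ(β)³ ≍ ξ(β)^{5-η}`).

## References

* H. Duminil-Copin, R. Panis, Comm. Math. Phys. 406 (2025), arXiv:2404.05700, Thm. 1.4, Rem. 1.7
  [DuminilCopinPanis2025LowerBounds].
* M. Aizenman, D. Barsky, R. Fernández, J. Stat. Phys. 47 (1987), Thm. 1 [AizenmanBarskyFernandezJSP1987].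
* H. Duminil-Copin, Lectures on the Ising and Potts models (2019), Thm. 4.8 [DuminilCopin2019].
* S. Friedli, Y. Velenik, Statistical Mechanics of Lattice Systems (CUP 2017), §3.7.4 [FriedliVelenik2017].
-/

noncomputable section

namespace Summit.CriticalPhenomena.Ising3DConformalLimit.LeeYangGapNearCriticalLeeYangGap

open Literature.Probability.LatticeModels Filter Set Finset
open scoped Topology BigOperators ENNReal
open Summit.CriticalPhenomena.Ising3DConformalLimit.PerfectScreeningCoulombImpliesNontrivial
  (plusExpect_blockSq_eq_sum sum_box_criticalTwoPoint_sub_le sum_box_criticalTwoPoint_le)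
open Summit.CriticalPhenomena.Ising3DConformalLimit.LeeYangGapGaussianLimitKillsBlockCoupling
  (card_mul_boxSum_le_blockSum boxSum_mono)

/-! ### Finite partial sums of the susceptibility -/

/-- **Finite partial sums of the susceptibility**: for `β ≥ 0` with `χ(β) < ∞` and every finite
`S ⊂ ℤ^d`, `Σ_{z ∈ S} ⟨σ₀σ_z⟩^∅_β ≤ χ(β)` (the summands are `≥ 0` by GKS I, and `χ = Σ'`).
(Friedli–Velenik 2017, §3.7.4, eq. (3.67).) -/
theorem sum_twoPointFree_le_susceptibility_toReal {d : ℕ} {β : ℝ} (hβ : 0 ≤ β)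
    (hχ : susceptibility d β ≠ ⊤) (S : Finset (Site d)) :
    ∑ z ∈ S, twoPointFree d β z ≤ (susceptibility d β).toReal := by
  have hgks : ∀ {Λ A : Finset (Site d)} {β h : ℝ} {bc : BoundaryCondition (Site d)},
      gks_one (zdGraph d) (Λ := Λ) (A := A) (β := β) (h := h) (bc := bc) :=
    Literature.Probability.LatticeModels.GKSInequalities.gks_one_holds (zdGraph d)
  have h0 : ∀ z, 0 ≤ twoPointFree d β z := fun z =>
    twoPointFree_nonneg hasBoxLimit_isingCorr_free_holds hgks hβ z
  have h1 : ENNReal.ofReal (∑ z ∈ S, twoPointFree d β z) ≤ susceptibility d β := by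
    rw [ENNReal.ofReal_sum_of_nonneg fun z _ => h0 z]
    exact ENNReal.sum_le_tsum S
  exact (ENNReal.ofReal_le_iff_le_toReal hχ).1 h1

/-- Below `β_c(3)` the box partial sums are bounded by the (finite) susceptibility:
`Σ_{z ∈ Λ_n} ⟨σ₀σ_z⟩^∅_β ≤ χ(β)` for `0 ≤ β < β_c(3)` (`χ(β) < ∞` by sharpness,
Aizenman–Barsky–Fernández 1987, tree theorem `susceptibility_lt_top_of_lt_criticalBeta`). -/
theorem sum_box_twoPointFree_le_susceptibility_toReal {β : ℝ} (hβ : 0 ≤ β)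
    (hβc : β < criticalBeta 3) (n : ℕ) :
    ∑ z ∈ box 3 n, twoPointFree 3 β z ≤ (susceptibility 3 β).toReal :=
  sum_twoPointFree_le_susceptibility_toReal hβ
    (susceptibility_lt_top_of_lt_criticalBeta (d := 3) (by norm_num) hβ hβc).ne (box 3 n)

/-! ### The correlation length on `(0, β_c)`: positivity and monotonicity -/

/-- **`0 < ξ(β)` for `0 < β < β_c(3)`**: the axis mass `ξ(β)⁻¹ = ξ_β(e₁)` is positive below `β_c`
(sharpness of the phase transition, Aizenman–Barsky–Fernández 1987; tree theorem
`dirInvCorrLength_pos`), and `ξ = (ξ_β(e₁))⁻¹` (`isingCorrLength_eq_inv_dirInvCorrLength`). -/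
theorem isingCorrLength_pos {β : ℝ} (hβ : 0 < β) (hβc : β < criticalBeta 3) :
    0 < isingCorrLength 3 β := by
  rw [isingCorrLength_eq_inv_dirInvCorrLength hβ.le]
  exact inv_pos.2 (dirInvCorrLength_pos (d := 3) (by norm_num) hβ hβc (by simp))

/-- **`ξ` is nondecreasing on `(0, β_c(3))`**: the mass `ξ_β(e₁)` is non-increasing in `β` (GKS II,
tree theorem `dirInvCorrLength_anti`) and positive below `β_c`. -/
theorem isingCorrLength_mono {β β' : ℝ} (hβ : 0 < β) (hββ' : β ≤ β') (hβc : β' < criticalBeta 3) :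
    isingCorrLength 3 β ≤ isingCorrLength 3 β' := by
  rw [isingCorrLength_eq_inv_dirInvCorrLength hβ.le,
    isingCorrLength_eq_inv_dirInvCorrLength (hβ.trans_le hββ').le]
  refine inv_anti₀ ?_ (dirInvCorrLength_anti hβ hββ' _)
  exact dirInvCorrLength_pos (d := 3) (by norm_num) (hβ.trans_le hββ') hβc (by simp)

/-! ### The critical block variance against the box two-point sum -/

/-- **`Σ_L ≤ |Λ_L| χ_{2L}(β_c)`**: `Σ_L = Σ_{x,y ∈ Λ_L} ⟨σ₀σ_{y-x}⟩_{β_c}` (`plusExpect_blockSq_eq_sum`),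
and each row `Σ_{y ∈ Λ_L} ⟨σ₀σ_{y-x}⟩_{β_c}` is at most `Σ_{z ∈ Λ_{2L}} ⟨σ₀σ_z⟩_{β_c}`
(`sum_box_criticalTwoPoint_sub_le`: `Λ_L - x ⊆ Λ_{2L}`, `⟨σ₀σ_z⟩ ≥ 0`). -/
theorem criticalBlockVariance_le_card_mul_boxSum (L : ℕ) :
    plusExpect 3 (criticalBeta 3) 0 (fun σ => (∑ x ∈ box 3 L, spinAt x σ) ^ 2) ≤
      ((2 * L + 1) ^ 3 : ℕ) * ∑ z ∈ box 3 (2 * L), twoPointPlus 3 (criticalBeta 3) z := by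
  rw [plusExpect_blockSq_eq_sum 3 L]
  calc ∑ p ∈ box 3 L ×ˢ box 3 L, criticalTwoPoint 3 (p.2 - p.1)
      = ∑ x ∈ box 3 L, ∑ y ∈ box 3 L, criticalTwoPoint 3 (y - x) := Finset.sum_product _ _ _
    _ ≤ ∑ _x ∈ box 3 L, ∑ z ∈ box 3 (2 * L), criticalTwoPoint 3 z :=
        Finset.sum_le_sum fun x hx => sum_box_criticalTwoPoint_sub_le hx
    _ = ((2 * L + 1) ^ 3 : ℕ) * ∑ z ∈ box 3 (2 * L), criticalTwoPoint 3 z := by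
        rw [Finset.sum_const, card_box, nsmul_eq_mul]
    _ = ((2 * L + 1) ^ 3 : ℕ) * ∑ z ∈ box 3 (2 * L), twoPointPlus 3 (criticalBeta 3) z := rfl

/-! ### The unconditional infrared half: `Σ_L ≤ C L⁵` -/

/-- **`Σ_L ≤ C L⁵` for `L ≥ 1`, unconditionally** (the infrared half of `Σ_L ≍ L^{5-η}`):
`Σ_L ≤ |Λ_L| χ_{2L}(β_c) ≤ 27 L³ · K (2L)²`, by the infrared bound `⟨σ₀σ_z⟩_{β_c} ≤ C/‖z‖_∞` summed
over `Λ_{2L}` (`sum_box_criticalTwoPoint_le`, from `criticalTwoPoint_bounds_holds`: Fröhlich–Simon–Spencer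
1976, Duminil-Copin 2019 Thm. 4.8). -/
theorem criticalBlockVariance_le_pow_five :
    ∃ C : ℝ, 0 < C ∧ ∀ L : ℕ, 1 ≤ L →
      plusExpect 3 (criticalBeta 3) 0 (fun σ => (∑ x ∈ box 3 L, spinAt x σ) ^ 2) ≤
        C * (L : ℝ) ^ 5 := by
  obtain ⟨K, hK0, hK⟩ := sum_box_criticalTwoPoint_le
  refine ⟨27 * 4 * (K + 1), by positivity, fun L hL => ?_⟩
  have hL1 : (1 : ℝ) ≤ L := by exact_mod_cast hL
  have hT := hK (2 * L) (by omega)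
  calc plusExpect 3 (criticalBeta 3) 0 (fun σ => (∑ x ∈ box 3 L, spinAt x σ) ^ 2)
      ≤ ((2 * L + 1) ^ 3 : ℕ) * ∑ z ∈ box 3 (2 * L), twoPointPlus 3 (criticalBeta 3) z :=
        criticalBlockVariance_le_card_mul_boxSum L
    _ ≤ ((2 * L + 1) ^ 3 : ℕ) * (K * ((2 * L : ℕ) : ℝ) ^ 2) :=
        mul_le_mul_of_nonneg_left hT (by positivity)
    _ ≤ 27 * 4 * (K + 1) * (L : ℝ) ^ 5 := by
        push_cast
        have h27 : (2 * (L : ℝ) + 1) ^ 3 ≤ 27 * (L : ℝ) ^ 3 := by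
          have h3' : (2 * (L : ℝ) + 1) ^ 3 ≤ (3 * (L : ℝ)) ^ 3 :=
            pow_le_pow_left₀ (by positivity) (by linarith) 3
          nlinarith [h3']
        have hKL : 0 ≤ K * (2 * (L : ℝ)) ^ 2 := by positivity
        have hL5 : 0 ≤ (L : ℝ) ^ 5 := by positivity
        calc (2 * (L : ℝ) + 1) ^ 3 * (K * (2 * (L : ℝ)) ^ 2)
            ≤ 27 * (L : ℝ) ^ 3 * (K * (2 * (L : ℝ)) ^ 2) := mul_le_mul_of_nonneg_right h27 hKL
          _ = 27 * 4 * K * (L : ℝ) ^ 5 := by ring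
          _ ≤ 27 * 4 * (K + 1) * (L : ℝ) ^ 5 := by nlinarith [hL5]

/-! ### Pointwise comparability implies averaged comparability -/

/-- **Pointwise near-critical comparability at one window scale implies the averaged form**: if
`⟨σ₀σ_z⟩⁺_{β_c} ≤ A ⟨σ₀σ_z⟩^∅_β` whenever `β ∈ [β₂, β_c)` and `‖z‖_∞ ≤ R ξ(β)`, then for
`β ∈ [β₂ ∨ 0, β_c)` and `n ≤ R ξ(β)`, `Σ_{z ∈ Λ_n} ⟨σ₀σ_z⟩⁺_{β_c} ≤ A χ(β)`: sum the pointwise bound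
over `Λ_n` (all `‖z‖_∞ ≤ n`) and use `Σ_{Λ_n} ⟨σ₀σ_z⟩^∅_β ≤ χ(β) < ∞` (`β ≥ 0` is needed for the
latter). -/
theorem boxSum_le_of_twoPoint_le {R A β₂ : ℝ} (hA : 0 < A)
    (H : ∀ β : ℝ, β₂ ≤ β → β < criticalBeta 3 → ∀ z : Site 3,
        ‖z‖ ≤ R * isingCorrLength 3 β →
        twoPointPlus 3 (criticalBeta 3) z ≤ A * twoPointFree 3 β z) :
    ∀ β : ℝ, max β₂ 0 ≤ β → β < criticalBeta 3 → ∀ n : ℕ,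
        (n : ℝ) ≤ R * isingCorrLength 3 β →
        ∑ z ∈ box 3 n, twoPointPlus 3 (criticalBeta 3) z ≤ A * (susceptibility 3 β).toReal := by
  intro β hβ₂β hββc n hn
  have hβ0 : 0 ≤ β := le_trans (le_max_right _ _) hβ₂β
  have hβ₂' : β₂ ≤ β := le_trans (le_max_left _ _) hβ₂β
  have hpt : ∀ z ∈ box 3 n, twoPointPlus 3 (criticalBeta 3) z ≤ A * twoPointFree 3 β z := by
    intro z hz
    refine H β hβ₂' hββc z (le_trans ?_ hn)
    rw [Site.norm_eq_supNorm]
    exact_mod_cast mem_box_iff_supNorm_le.1 hz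
  calc ∑ z ∈ box 3 n, twoPointPlus 3 (criticalBeta 3) z
      ≤ ∑ z ∈ box 3 n, A * twoPointFree 3 β z := Finset.sum_le_sum hpt
    _ = A * ∑ z ∈ box 3 n, twoPointFree 3 β z := by rw [Finset.mul_sum]
    _ ≤ A * (susceptibility 3 β).toReal :=
        mul_le_mul_of_nonneg_left (sum_box_twoPointFree_le_susceptibility_toReal hβ0 hββc n) hA.le

/-- **Pointwise near-critical comparability implies the averaged form** (all window scales): if
for every `R > 0` there are `A > 0` and `β₂ < β_c` with `⟨σ₀σ_z⟩⁺_{β_c} ≤ A ⟨σ₀σ_z⟩^∅_β` whenever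
`β ∈ [β₂, β_c)` and `‖z‖_∞ ≤ R ξ(β)`, then (same `R`, `A`; `β₂` raised to `≥ 0`)
`Σ_{z ∈ Λ_n} ⟨σ₀σ_z⟩⁺_{β_c} ≤ A χ(β)` whenever `n ≤ R ξ(β)` (`boxSum_le_of_twoPoint_le`). The
hypothesis is the `ℤ³` analogue of Duminil-Copin–Panis 2025, Thm. 1.4 / Rem. 1.7 (`d ≥ 5`, within
the sharp length); it is open on `ℤ³`. -/
theorem susceptibilityComparability_of_twoPointComparability
    (hcomp : ∀ R : ℝ, 0 < R → ∃ A β₂ : ℝ, 0 < A ∧ β₂ < criticalBeta 3 ∧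
      ∀ β : ℝ, β₂ ≤ β → β < criticalBeta 3 → ∀ z : Site 3,
        ‖z‖ ≤ R * isingCorrLength 3 β →
        twoPointPlus 3 (criticalBeta 3) z ≤ A * twoPointFree 3 β z) :
    ∀ R : ℝ, 0 < R → ∃ A β₂ : ℝ, 0 < A ∧ β₂ < criticalBeta 3 ∧
      ∀ β : ℝ, β₂ ≤ β → β < criticalBeta 3 → ∀ n : ℕ,
        (n : ℝ) ≤ R * isingCorrLength 3 β →
        ∑ z ∈ box 3 n, twoPointPlus 3 (criticalBeta 3) z ≤ A * (susceptibility 3 β).toReal := by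
  intro R hR
  obtain ⟨A, β₂, hA, hβ₂, H⟩ := hcomp R hR
  have hβc : 0 < criticalBeta 3 := criticalBeta_pos_holds (d := 3) (by norm_num)
  exact ⟨A, max β₂ 0, hA, max_lt hβ₂ hβc, boxSum_le_of_twoPoint_le hA H⟩

/-! ### The reductions of the stub -/

/-- **The critical-window variance bound at window constant `K` from the averaged comparability at
scale `2K`** (the core of the reduction): if `A > 0`, `β₂ < β_c` and
`Σ_{z ∈ Λ_n} ⟨σ₀σ_z⟩⁺_{β_c} ≤ A χ(β)` for all `β ∈ [β₂, β_c)` and `n ≤ 2K ξ(β)`, then with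
`β₂' := β₂ ∨ β_c/2`, `ξ₀ := ξ(β₂') > 0` and `B := A (2K + 1/ξ₀)³`: for `β ∈ [β₂', β_c)` and
`L ≤ K ξ(β)`, `Σ_L ≤ |Λ_L| χ_{2L}(β_c) ≤ (2L+1)³ A χ(β) ≤ B χ(β) ξ(β)³`, using `ξ(β) ≥ ξ₀` (`ξ` is
positive and nondecreasing on `(0, β_c)`), so that `2L + 1 ≤ 2Kξ(β) + ξ(β)/ξ₀`. -/
theorem criticalWindowVariance_of_boxSum_le {K A β₂ : ℝ} (hK : 0 < K) (hA : 0 < A)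
    (hβ₂ : β₂ < criticalBeta 3)
    (H : ∀ β : ℝ, β₂ ≤ β → β < criticalBeta 3 → ∀ n : ℕ,
        (n : ℝ) ≤ 2 * K * isingCorrLength 3 β →
        ∑ z ∈ box 3 n, twoPointPlus 3 (criticalBeta 3) z ≤ A * (susceptibility 3 β).toReal) :
    ∃ B β₂' : ℝ, 0 < B ∧ β₂' < criticalBeta 3 ∧
      ∀ β : ℝ, β₂' ≤ β → β < criticalBeta 3 → ∀ L : ℕ,
        (L : ℝ) ≤ K * isingCorrLength 3 β →
        plusExpect 3 (criticalBeta 3) 0 (fun σ => (∑ x ∈ box 3 L, spinAt x σ) ^ 2) ≤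
          B * (susceptibility 3 β).toReal * isingCorrLength 3 β ^ 3 := by
  have hβc : 0 < criticalBeta 3 := criticalBeta_pos_holds (d := 3) (by norm_num)
  -- raise `β₂` to `≥ β_c/2 > 0`
  set β₁ : ℝ := max β₂ (criticalBeta 3 / 2) with hβ₁def
  have hβ₁c : β₁ < criticalBeta 3 := max_lt hβ₂ (by linarith)
  have hβ₁pos : 0 < β₁ := lt_of_lt_of_le (by linarith) (le_max_right _ _)
  set ξ₀ : ℝ := isingCorrLength 3 β₁ with hξ₀def
  have hξ₀ : 0 < ξ₀ := isingCorrLength_pos hβ₁pos hβ₁c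
  refine ⟨A * (2 * K + 1 / ξ₀) ^ 3, β₁, by positivity, hβ₁c, fun β hβ₁β hββc L hL => ?_⟩
  have hβ₂β : β₂ ≤ β := le_trans (le_max_left _ _) hβ₁β
  have hξ : ξ₀ ≤ isingCorrLength 3 β := isingCorrLength_mono hβ₁pos hβ₁β hββc
  have hξpos : 0 < isingCorrLength 3 β := hξ₀.trans_le hξ
  -- the averaged comparability at scale `2L ≤ 2K ξ(β)`
  have h2L : ((2 * L : ℕ) : ℝ) ≤ 2 * K * isingCorrLength 3 β := by push_cast; linarith
  have hbox := H β hβ₂β hββc (2 * L) h2L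
  -- `2L + 1 ≤ (2K + 1/ξ₀) ξ(β)`
  have hcard : (2 * (L : ℝ) + 1) ≤ (2 * K + 1 / ξ₀) * isingCorrLength 3 β := by
    have h1 : (1 : ℝ) ≤ 1 / ξ₀ * isingCorrLength 3 β := by
      rw [one_div, ← div_eq_inv_mul, le_div_iff₀ hξ₀, one_mul]
      exact hξ
    nlinarith [h1, hL]
  have hcard3 : (2 * (L : ℝ) + 1) ^ 3 ≤ ((2 * K + 1 / ξ₀) * isingCorrLength 3 β) ^ 3 :=
    pow_le_pow_left₀ (by positivity) hcard 3
  calc plusExpect 3 (criticalBeta 3) 0 (fun σ => (∑ x ∈ box 3 L, spinAt x σ) ^ 2)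
      ≤ ((2 * L + 1) ^ 3 : ℕ) * ∑ z ∈ box 3 (2 * L), twoPointPlus 3 (criticalBeta 3) z :=
        criticalBlockVariance_le_card_mul_boxSum L
    _ ≤ ((2 * L + 1) ^ 3 : ℕ) * (A * (susceptibility 3 β).toReal) :=
        mul_le_mul_of_nonneg_left hbox (by positivity)
    _ = (2 * (L : ℝ) + 1) ^ 3 * (A * (susceptibility 3 β).toReal) := by push_cast; ring
    _ ≤ ((2 * K + 1 / ξ₀) * isingCorrLength 3 β) ^ 3 * (A * (susceptibility 3 β).toReal) :=
        mul_le_mul_of_nonneg_right hcard3 (by positivity)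
    _ = A * (2 * K + 1 / ξ₀) ^ 3 * (susceptibility 3 β).toReal * isingCorrLength 3 β ^ 3 := by
        ring

/-- **S2 from the averaged near-critical comparability** (registered stub S2g of the reshaped skeleton,
line `registered`, crux stmt-CriticalPhenomena-4945; the hypothesis — registered stub S2χ
`stub_susceptibilityComparability` — is the missing estimate, open on `ℤ³`): if for every `R > 0` there
are `A > 0`, `β₂ < β_c` with `Σ_{z ∈ Λ_n} ⟨σ₀σ_z⟩⁺_{β_c} ≤ A χ(β)` for all `β ∈ [β₂, β_c)` and
`n ≤ R ξ(β)`, then the birth stub `stub_criticalWindowVariance` holds verbatim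
(`criticalWindowVariance_of_boxSum_le` at `R = 2K`). -/
theorem stub_criticalWindowVariance_of_susceptibilityComparability :
    (∀ R : ℝ, 0 < R → ∃ A β₂ : ℝ, 0 < A ∧ β₂ < Literature.Probability.LatticeModels.criticalBeta 3 ∧
      ∀ β : ℝ, β₂ ≤ β → β < Literature.Probability.LatticeModels.criticalBeta 3 → ∀ n : ℕ,
        (n : ℝ) ≤ R * Literature.Probability.LatticeModels.isingCorrLength 3 β →
        ∑ z ∈ Literature.Probability.LatticeModels.box 3 n,
            Literature.Probability.LatticeModels.twoPointPlus 3
              (Literature.Probability.LatticeModels.criticalBeta 3) z ≤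
          A * (Literature.Probability.LatticeModels.susceptibility 3 β).toReal) →
    ∀ K : ℝ, 0 < K → ∃ B β₂ : ℝ, 0 < B ∧ β₂ < Literature.Probability.LatticeModels.criticalBeta 3 ∧
      ∀ β : ℝ, β₂ ≤ β → β < Literature.Probability.LatticeModels.criticalBeta 3 → ∀ L : ℕ,
        (L : ℝ) ≤ K * Literature.Probability.LatticeModels.isingCorrLength 3 β →
        Literature.Probability.LatticeModels.plusExpect 3 (Literature.Probability.LatticeModels.criticalBeta 3) 0
            (fun σ => (∑ x ∈ Literature.Probability.LatticeModels.box 3 L,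
              Literature.Probability.LatticeModels.spinAt x σ) ^ 2) ≤
          B * (Literature.Probability.LatticeModels.susceptibility 3 β).toReal *
            Literature.Probability.LatticeModels.isingCorrLength 3 β ^ 3 := by
  intro hχ K hK
  obtain ⟨A, β₂, hA, hβ₂, H⟩ := hχ (2 * K) (by positivity)
  exact criticalWindowVariance_of_boxSum_le hK hA hβ₂ H

/-- **S2 from pointwise near-critical two-point comparability** (`ℤ³` analogue of
Duminil-Copin–Panis 2025, Thm. 1.4 / Rem. 1.7, which give it for `d ≥ 5` within the sharp length
`L(β) ≍ ξ(β)`; open for `d = 3`): if for every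
`R > 0` there are `A > 0`, `β₂ < β_c` with `⟨σ₀σ_z⟩⁺_{β_c} ≤ A ⟨σ₀σ_z⟩^∅_β` for all `β ∈ [β₂, β_c)` and
`‖z‖_∞ ≤ R ξ(β)`, then `stub_criticalWindowVariance` holds verbatim
(`susceptibilityComparability_of_twoPointComparability` then
`stub_criticalWindowVariance_of_susceptibilityComparability`). -/
theorem stub_criticalWindowVariance_of_comparability
    (hcomp : ∀ R : ℝ, 0 < R → ∃ A β₂ : ℝ, 0 < A ∧ β₂ < criticalBeta 3 ∧
      ∀ β : ℝ, β₂ ≤ β → β < criticalBeta 3 → ∀ z : Site 3,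
        ‖z‖ ≤ R * isingCorrLength 3 β →
        twoPointPlus 3 (criticalBeta 3) z ≤ A * twoPointFree 3 β z) :
    ∀ K : ℝ, 0 < K → ∃ B β₂ : ℝ, 0 < B ∧ β₂ < Literature.Probability.LatticeModels.criticalBeta 3 ∧
      ∀ β : ℝ, β₂ ≤ β → β < Literature.Probability.LatticeModels.criticalBeta 3 → ∀ L : ℕ,
        (L : ℝ) ≤ K * Literature.Probability.LatticeModels.isingCorrLength 3 β →
        Literature.Probability.LatticeModels.plusExpect 3 (Literature.Probability.LatticeModels.criticalBeta 3) 0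
            (fun σ => (∑ x ∈ Literature.Probability.LatticeModels.box 3 L,
              Literature.Probability.LatticeModels.spinAt x σ) ^ 2) ≤
          B * (Literature.Probability.LatticeModels.susceptibility 3 β).toReal *
            Literature.Probability.LatticeModels.isingCorrLength 3 β ^ 3 :=
  stub_criticalWindowVariance_of_susceptibilityComparability
    (susceptibilityComparability_of_twoPointComparability hcomp)

/-! ### The converse: the stub implies the averaged comparability -/

/-- **Conversely, S2 implies the averaged near-critical comparability**, so the hypothesis of
`stub_criticalWindowVariance_of_susceptibilityComparability` is exactly the content of the stub:
given `R > 0`, apply S2 with `K = 2R + 2 + 2/ξ₀` (`ξ₀ = ξ(β_c/2) > 0`); for `β ∈ [β₂ ∨ β_c/2, β_c)`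
and `n ≤ R ξ(β)` put `n₀ = ⌈(R+1) ξ(β)⌉ ≥ n`, `L = 2n₀ ≤ K ξ(β)`; then
`(2n₀+1)³ χ_{n₀}(β_c) ≤ |Λ_{n₀}| χ_{n₀}(β_c) ≤ Σ_L ≤ B χ(β) ξ(β)³` (`card_mul_boxSum_le_blockSum`) and
`2n₀ + 1 ≥ 2(R+1) ξ(β)`, whence `χ_n(β_c) ≤ χ_{n₀}(β_c) ≤ B/(8(R+1)³) χ(β)`. -/
theorem susceptibilityComparability_of_stub_criticalWindowVariance
    (hS : ∀ K : ℝ, 0 < K → ∃ B β₂ : ℝ, 0 < B ∧ β₂ < criticalBeta 3 ∧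
      ∀ β : ℝ, β₂ ≤ β → β < criticalBeta 3 → ∀ L : ℕ,
        (L : ℝ) ≤ K * isingCorrLength 3 β →
        plusExpect 3 (criticalBeta 3) 0 (fun σ => (∑ x ∈ box 3 L, spinAt x σ) ^ 2) ≤
          B * (susceptibility 3 β).toReal * isingCorrLength 3 β ^ 3) :
    ∀ R : ℝ, 0 < R → ∃ A β₂ : ℝ, 0 < A ∧ β₂ < criticalBeta 3 ∧
      ∀ β : ℝ, β₂ ≤ β → β < criticalBeta 3 → ∀ n : ℕ,
        (n : ℝ) ≤ R * isingCorrLength 3 β →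
        ∑ z ∈ box 3 n, twoPointPlus 3 (criticalBeta 3) z ≤ A * (susceptibility 3 β).toReal := by
  intro R hR
  have hβc : 0 < criticalBeta 3 := criticalBeta_pos_holds (d := 3) (by norm_num)
  have hhalf : criticalBeta 3 / 2 < criticalBeta 3 := by linarith
  have hhalfpos : 0 < criticalBeta 3 / 2 := by linarith
  obtain ⟨ξ₀, hξ₀def⟩ : ∃ ξ₀ : ℝ, ξ₀ = isingCorrLength 3 (criticalBeta 3 / 2) := ⟨_, rfl⟩
  have hξ₀ : 0 < ξ₀ := hξ₀def ▸ isingCorrLength_pos hhalfpos hhalf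
  obtain ⟨B, β₂, hB, hβ₂, H⟩ := hS (2 * R + 2 + 2 / ξ₀) (by positivity)
  refine ⟨B / (8 * (R + 1) ^ 3), max β₂ (criticalBeta 3 / 2), by positivity, max_lt hβ₂ hhalf,
    fun β hβ₁β hββc n hn => ?_⟩
  have hβ₂β : β₂ ≤ β := le_trans (le_max_left _ _) hβ₁β
  have hhalfβ : criticalBeta 3 / 2 ≤ β := le_trans (le_max_right _ _) hβ₁β
  -- `ξ := ξ(β) ≥ ξ₀ > 0`
  obtain ⟨ξ, hξdef⟩ : ∃ ξ : ℝ, ξ = isingCorrLength 3 β := ⟨_, rfl⟩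
  have hξ : ξ₀ ≤ ξ := by
    rw [hξ₀def, hξdef]; exact isingCorrLength_mono hhalfpos hhalfβ hββc
  have hξpos : 0 < ξ := hξ₀.trans_le hξ
  have Hβ := H β hβ₂β hββc
  rw [← hξdef] at hn Hβ
  -- the scale `n₀ = ⌈(R+1) ξ⌉ ≥ n` and the block `L = 2 n₀ ≤ K ξ`
  obtain ⟨n₀, hn₀ge, hn₀lt⟩ : ∃ n₀ : ℕ, (R + 1) * ξ ≤ n₀ ∧ (n₀ : ℝ) < (R + 1) * ξ + 1 :=
    ⟨⌈(R + 1) * ξ⌉₊, Nat.le_ceil _, Nat.ceil_lt_add_one (by positivity)⟩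
  have hnn₀ : n ≤ n₀ := by
    have h : (n : ℝ) ≤ n₀ := by nlinarith [hn, hn₀ge, hξpos]
    exact_mod_cast h
  have hL : ((2 * n₀ : ℕ) : ℝ) ≤ (2 * R + 2 + 2 / ξ₀) * ξ := by
    have h2 : (2 : ℝ) ≤ 2 / ξ₀ * ξ := by
      rw [div_mul_eq_mul_div, le_div_iff₀ hξ₀]
      linarith
    push_cast
    calc 2 * (n₀ : ℝ) ≤ 2 * ((R + 1) * ξ) + 2 := by linarith
      _ ≤ 2 * ((R + 1) * ξ) + 2 / ξ₀ * ξ := by linarith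
      _ = (2 * R + 2 + 2 / ξ₀) * ξ := by ring
  have hblock := Hβ (2 * n₀) hL
  -- `|Λ_{n₀}| χ_{n₀}(β_c) ≤ Σ_{2n₀}`
  have hlow : (#(box 3 n₀) : ℝ) * ∑ z ∈ box 3 n₀, criticalTwoPoint 3 z ≤
      plusExpect 3 (criticalBeta 3) 0 (fun σ => (∑ x ∈ box 3 (2 * n₀), spinAt x σ) ^ 2) := by
    have h := card_mul_boxSum_le_blockSum (d := 3) (2 * n₀)
    have e2 : 2 * n₀ / 2 = n₀ := Nat.mul_div_cancel_left n₀ (by norm_num)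
    rw [e2] at h
    rwa [plusExpect_blockSpin_sq_eq_sum]
  have hcardge : (2 * (R + 1) * ξ) ^ 3 ≤ (#(box 3 n₀) : ℝ) := by
    rw [card_box]
    push_cast
    exact pow_le_pow_left₀ (by positivity) (by linarith) 3
  have hsum0 : 0 ≤ ∑ z ∈ box 3 n₀, criticalTwoPoint 3 z :=
    Finset.sum_nonneg fun z _ => criticalTwoPoint_nonneg' z
  -- combine: `8 (R+1)³ ξ³ χ_{n₀}(β_c) ≤ B χ(β) ξ³`
  have hmain : (2 * (R + 1) * ξ) ^ 3 * ∑ z ∈ box 3 n₀, criticalTwoPoint 3 z ≤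
      B * (susceptibility 3 β).toReal * ξ ^ 3 :=
    le_trans (le_trans (mul_le_mul_of_nonneg_right hcardge hsum0) hlow) hblock
  have hξ3 : 0 < ξ ^ 3 := by positivity
  have h8 : 8 * (R + 1) ^ 3 * ∑ z ∈ box 3 n₀, criticalTwoPoint 3 z ≤
      B * (susceptibility 3 β).toReal := by
    refine le_of_mul_le_mul_right ?_ hξ3
    calc 8 * (R + 1) ^ 3 * (∑ z ∈ box 3 n₀, criticalTwoPoint 3 z) * ξ ^ 3
        = (2 * (R + 1) * ξ) ^ 3 * ∑ z ∈ box 3 n₀, criticalTwoPoint 3 z := by ring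
      _ ≤ B * (susceptibility 3 β).toReal * ξ ^ 3 := hmain
  have hkey : ∑ z ∈ box 3 n₀, criticalTwoPoint 3 z ≤
      B / (8 * (R + 1) ^ 3) * (susceptibility 3 β).toReal := by
    rw [div_mul_eq_mul_div, le_div_iff₀ (by positivity)]
    linarith
  calc ∑ z ∈ box 3 n, twoPointPlus 3 (criticalBeta 3) z
      = ∑ z ∈ box 3 n, criticalTwoPoint 3 z := rfl
    _ ≤ ∑ z ∈ box 3 n₀, criticalTwoPoint 3 z := boxSum_mono hnn₀
    _ ≤ B / (8 * (R + 1) ^ 3) * (susceptibility 3 β).toReal := hkey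

end Summit.CriticalPhenomena.Ising3DConformalLimit.LeeYangGapNearCriticalLeeYangGap

end
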